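/-
Origin: expansion seat `prover-pub-hodgecm-mc-sinst-1-g9-0`, handover #1239 2026-08-20T21:03Z md5 f578f4aea9e3 (473 l.; NEW additive leaf, ns HodgeCM.Model.ThetaSpace / HodgeCM.Model / HodgeCM.Model.ThetaAdelicSide; imports #1238 + PKG Model/LevelConjugate + Model/ThetaGenExports + Model/ThetaHolGerm; SECTION-SIDE inputs of binder-1's cohomological theta family c ∈ towerLevel: `ThetaAdelicSide.compAt hV F h` (component of index h ∈ U(V)(𝔸_f): x ↦ F (S.ιinf x · finToG V hV h)) + `compAt_one`/`compAt_mul`/`compAt_adelicThetaRepFin` (re-indexing = binder-1 translate_apply), `ThetaSpace.apply_mul_ιinf_of_mem_adelicThetaSpan` + `compAt_mul_κ₁` (weight τ₁), `compAt_levelImage_mul` (left-invariance under levelImage (Γ.conj h hΓ) for F saturated at sat(Γ.K): rat_split_level corrector + theta-3's discharged hK), `compAt_mem_weightForms`, `compAt_mem_holWeightForms` (holomorphic when F ∈ holGerms S.ιinf), abbrev `pinD` (= (thetaSpaceInputIn …).D Δ, rfl) + `exists_unique_pull_eq_compAt` / `compClass` / `pull_compClass` / `compClass_unique` / `pull_compClass_mem_Hol`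 (the component CLASS in F¹H¹(P_(Γ.conj h))); §4 `exists_toAdelic_eq_archSec_mul_mul_finAdelicToAdelic` + `exists_archInfOf_mul_mul_finToG_mem_Γ` (rational point = archInfOf(toBall g) · a · finToG (g)_f with a in every sat(K), central for ιinf and the finite factor), `compAt_mul_of_split`, `compAt_rationalToFinAdelic_mul` (for S.ιinf = archInfOf V: compAt F ((γ)_f h k) (toBall γ · x) = compAt F h x — the function identity under binder-1's Rel Γ γ h h', i.e. the hΘ of #R104 pull_mem_thetaClasses_of_apply_eq); NAME LIST: HodgeCM.Model.ThetaAdelicSide.compAt_levelImage_mul · HodgeCM.Model.ThetaAdelicSide.pull_compClass · HodgeCM.Model.ThetaAdelicSide.compAt_rationalToFinAdelic_mul) (`HOME/mc/pub-hodgecm-mc-sinst-1-g9/stage/HodgeCM/Model/AdelicThetaComponents.lean`, md5 f578f4aea9e3, 473 lines);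
landed by the gen-26 packager (p-g26) in gate run 63 as `HodgeCM/Model/AdelicThetaComponents.lean` (verbatim).
-/
/-
Copyright (c) 2026 the pub-hodgecm formalisation cell (harness21).  New file, not vendored.
Origin: session prover-pub-hodgecm-mc-sinst-1-g9-0 (unit pub-hodgecm-mc-sinst-1-g9, S-INSTANCE CONSTRUCTOR gen 9; (J4) side of the
(J-Liu-Θ) junction behind E's row 9 `hΘ` — the SECTION-SIDE inputs of binder-1's cohomological theta family `c ∈ towerLevel`), 2026-08-20.
Intended final place: `HodgeCM/Model/AdelicThetaComponents.lean` (NEW additive model-layer leaf; imports sinst-1's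
`HodgeCM.Model.AdelicThetaModuleFin` (#1238), binder-1's `HodgeCM.Model.LevelConjugate` (#R106), discharge-1's
`HodgeCM.Model.Junction.LevelSaturationConj` and theta-3/autform-2's `HodgeCM.Model.ThetaHolGerm`; nothing imports it; drop alone).
-/
import Summits.HodgeConjecture.HodgeCM.Model.AdelicThetaModuleFin_2
import Summits.HodgeConjecture.HodgeCM.Model.LevelConjugate
import Summits.HodgeConjecture.HodgeCM.Model.ThetaGenExports
import Summits.HodgeConjecture.HodgeCM.Model.ThetaHolGerm

set_option autoImplicit false

/-!
# Components of a saturated adèlic theta form along the tower: holomorphic weight forms of the conjugate levels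

binder-1's level-`K` carrier of the tower (`Model/TowerLevel`, #R108) is the space of families `h ↦ c h ∈ H¹(P_{Γ.conj h})`
over the finite adèles `h ∈ U(V)(𝔸_{L⁺,f})`, `Γ.conj h = (U(V)(L⁺) ∩ hKh⁻¹, hKh⁻¹)` (#R106); the (J2)+(J4) input of the row-9
junction is the family of COMPONENT CLASSES of an adèlic theta form.  This leaf supplies the section side of that family, for ANY
adelic side `S : ThetaAdelicSide V c` in the anisotropic regime `hV`, from the pin fields only (`comm_fin`, `fin_mem_Gfin`,
`rat_split_level`, `hΓU`) and the saturation currency (`satLevelRegimeOf`, `Junction/LevelSaturationConj`):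

* `S.compAt hV F h : U(2,1) → W`, `x ↦ F (S.ιinf x · finToG V hV h)` — the component of index `h` of `F : G_U(𝔸) → W`;
  `compAt_one` (`= F ∘ S.ιinf`), `compAt_mul` (`compAt F (h g) = compAt (R_{e_g} F) h`), `compAt_adelicThetaRepFin`
  (the `U(V)(𝔸_f)`-action of #1238 re-indexes the components: binder-1's `translate_apply`);
* `ThetaSpace.apply_mul_ιinf_of_mem_adelicThetaSpan` — every element of the adèlic theta module has weight `τ₁` along
  `ιinf ∘ κ₁` (weight matching of each situation); hence `compAt_mul_κ₁`;
* **`compAt_levelImage_mul`** — for `F` SATURATED at `satLevelRegimeOf V hV Γ.K`, the component of index `h` is LEFT-INVARIANT under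
  the level image `levelImage … (Γ.conj h hΓ) hV` of the conjugate level (corrector of `rat_split_level` at level `hKh⁻¹`, left
  `Γ_U`-invariance, `conj_mem_satLevelRegimeOf` to bring the corrector back into `sat(K)`, saturation);
* **`compAt_mem_weightForms`** — so it is a weight form of level `levelImage (Γ.conj h hΓ)`, weight `τ₁` on `Stab(x₀)`;
* **`compAt_mem_holWeightForms`** — and HOLOMORPHIC as soon as `F` has holomorphic germs along `S.ιinf` (`IsHolGerm`, theta-3's
  `Model/ThetaHolGerm`; the germ of the component at `g` is the germ of `F` at `S.ιinf g · e_h`), by the tree criterion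
  `BallForms.mem_holWeightForms_of_differentiableAt`;
* **`exists_unique_pull_eq_compAt`** — hence it is `pull` of a UNIQUE `(1,0)`-class of the pin's class-map datum `pinD … (Γ.conj h hΓ) hV`
  (`= (thetaSpaceInputIn … S hV).D (Γ.conj h hΓ)`, `rfl`): `compClass` / `pull_compClass` / `compClass_unique` — the value at `h`
  of the cohomological family; `holSat` — the `ℂ`-submodule of saturated forms with holomorphic germs, and `compClass` is additive on it.
What is NOT here (binder-1's (J2) side, #R103/#R107/#R108): the relation `c h = t_γ^* (c h')` along `h' = (γ)_f h k`, i.e. the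
comparison of `compClass` at related indices through `transMorU`.

KERNEL only: 0 records, 0 `def … : Prop`, nothing cited; `#print axioms` ⊆ {propext, Classical.choice, Quot.sound}.
-/

noncomputable section

open MulAction NumberField
open Literature.NumberTheory.Automorphic Literature.NumberTheory.Weil1964
open Literature.NumberTheory.Automorphic.WeightForms (restrictHom thetaClasses IsLevelCorrected IsWeightMatched)
open Literature.Geometry.ComplexHyperbolic.BallModel (U21 x₀)
open Literature.AlgebraicGeometry.HodgeTheory Literature.AlgebraicGeometry.ShimuraVarieties
open Literature.NumberTheory.Automorphic.PicardCM
open Literature.NumberTheory.Automorphic.LevelOrbit (conjLevel mem_conjLevel_iff)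
open HodgeCM.Model.SupplyResidual HodgeCM.Model.ThetaSpace

namespace HodgeCM
namespace Model

/-! ## §1. Weight of the adèlic theta module along `ιinf ∘ κ₁` (any pair datum) -/

namespace ThetaSpace

section Generic

variable {K L : Type} [Field K] [NumberField K] [Field L] [NumberField L] [Algebra K L] [FiniteDimensional K L]
variable {J : Type} [Fintype J] {GU : Type} [Group GU] [TopologicalSpace GU] [IsTopologicalGroup GU]
  [LocallyCompactSpace GU]
variable {P : WeilPairData K L J GU} [CompactSpace (GU ⧸ P.ΓU)]
variable {G₁ K₁ W : Type} [Group G₁] [Group K₁] [AddCommGroup W] [Module ℂ W] [Module.IsReflexive ℂ W]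
variable {ιinf : G₁ →* GU} {κ₁ : K₁ →* G₁} {τ₁ : Representation ℂ K₁ W}
variable {𝓕 : Set C(NumberField.relNormOneIdeles K L ⧸ NumberField.relNormOneRat K L, ℂ)}

/-- **Every element of the adèlic theta module has weight `τ₁` along `ιinf ∘ κ₁`**: `F (y · ιinf (κ₁ u)) = τ₁(u)⁻¹ (F y)`
(each generating theta form is a weight form of its situation, whose weight is matched to `(κ₁, τ₁)` along `ιinf`). -/
theorem apply_mul_ιinf_of_mem_adelicThetaSpan {F : GU → W} (hF : F ∈ adelicThetaSpan P ιinf κ₁ τ₁ 𝓕) (u : K₁) (y : GU) :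
    F (y * ιinf (κ₁ u)) = τ₁ u⁻¹ (F y) := by
  revert y
  refine Submodule.iSup_induction _ (motive := fun F : GU → W => ∀ y, F (y * ιinf (κ₁ u)) = τ₁ u⁻¹ (F y)) hF ?_ ?_ ?_
  · rintro ⟨S, -⟩ F ⟨θ, -, rfl⟩ y
    show (θ : GU → W) (y * ιinf (κ₁ u)) = τ₁ u⁻¹ ((θ : GU → W) y)
    rw [← S.hη.1 u, θ.2.2 (S.η₁ u) y, ← map_inv, S.hη.2 u⁻¹]
  · intro y; simp
  · intro F F' hF hF' y
    simp only [Pi.add_apply, hF y, hF' y, map_add]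

end Generic

end ThetaSpace

/-! ## §2. Components of a function on the regime model group -/

namespace ThetaAdelicSide

variable {L : CMField} {ι₁ : L →+* ℂ} {V : HermSpace3 L ι₁} {c : SeesawCtx L} (S : ThetaAdelicSide V c)
variable {W : Type}

/-- **The component of index `h ∈ U(V)(𝔸_{L⁺,f})`** of a function `F` on `G_U(𝔸)`, read on `U(2,1)` through `S.ιinf`:
`x ↦ F (S.ιinf x · finToG V hV h)`. -/
def compAt (hV : IsAnisotropic L V.Hm) (F : (V.latticeModel printFact_unitaryCompact_holds).G → W) (h : V.adelicFin) :
    U21 → W :=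
  fun x => F (S.ιinf x * finToG V hV h)

/-- (Ported verbatim from the HodgeCMPerL package; no docstring in the source.) -/
@[simp] theorem compAt_apply (hV : IsAnisotropic L V.Hm) (F : (V.latticeModel printFact_unitaryCompact_holds).G → W)
    (h : V.adelicFin) (x : U21) : S.compAt hV F h x = F (S.ιinf x * finToG V hV h) := rfl

/-- The component of index `1` is the archimedean restriction `F ∘ S.ιinf`. -/
theorem compAt_one (hV : IsAnisotropic L V.Hm) (F : (V.latticeModel printFact_unitaryCompact_holds).G → W) :
    S.compAt hV F 1 = F ∘ S.ιinf := by
  funext x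
  show F (S.ιinf x * finToG V hV 1) = F (S.ιinf x)
  rw [map_one, mul_one]

variable [AddCommGroup W] [Module ℂ W]

/-- **Re-indexing is right translation**: `compAt F (h g) = compAt (R_{e_g} F) h`. -/
theorem compAt_mul (hV : IsAnisotropic L V.Hm) (F : (V.latticeModel printFact_unitaryCompact_holds).G → W)
    (h g : V.adelicFin) : S.compAt hV F (h * g) = S.compAt hV (rightShift (finToG V hV g) F) h := by
  funext x
  show F (S.ιinf x * finToG V hV (h * g)) = F (S.ιinf x * finToG V hV h * finToG V hV g)
  rw [map_mul, mul_assoc]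

variable {K₁ : Type} [Group K₁] [Module.IsReflexive ℂ W] {κ₁ : K₁ →* U21} {τ₁ : Representation ℂ K₁ W}
  {𝓕 : Set C(NumberField.relNormOneIdeles (↥(maximalRealSubfield L)) L ⧸ NumberField.relNormOneRat (↥(maximalRealSubfield L)) L, ℂ)}

/-- **The `U(V)(𝔸_f)`-action of #1238 re-indexes the components**: `compAt (g · F) h = compAt F (h g)` (binder-1's `translate_apply`). -/
theorem compAt_adelicThetaRepFin (hV : IsAnisotropic L V.Hm) (k : Fin 4) (F : adelicThetaSpan (S.P k) S.ιinf κ₁ τ₁ 𝓕)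
    (g h : V.adelicFin) :
    S.compAt hV (S.adelicThetaRepFin hV k κ₁ τ₁ 𝓕 g F).1 h = S.compAt hV F.1 (h * g) := by
  funext x
  show F.1 (S.ιinf x * finToG V hV h * finToG V hV g) = F.1 (S.ιinf x * finToG V hV (h * g))
  rw [map_mul, mul_assoc]

/-- **Weight of the components**: `compAt F h (x · κ₁ u) = τ₁(u)⁻¹ (compAt F h x)` for `F` in the slot's adèlic theta module. -/
theorem compAt_mul_κ₁ (hV : IsAnisotropic L V.Hm) {k : Fin 4} {F : (V.latticeModel printFact_unitaryCompact_holds).G → W}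
    (hF : F ∈ adelicThetaSpan (S.P k) S.ιinf κ₁ τ₁ 𝓕) (h : V.adelicFin) (x : U21) (u : K₁) :
    S.compAt hV F h (x * κ₁ u) = τ₁ u⁻¹ (S.compAt hV F h x) := by
  show F (S.ιinf (x * κ₁ u) * finToG V hV h) = τ₁ u⁻¹ (F (S.ιinf x * finToG V hV h))
  rw [map_mul, mul_assoc, ← (S.commute_finToG_ιinf hV h (κ₁ u)).eq, ← mul_assoc]
  exact apply_mul_ιinf_of_mem_adelicThetaSpan hF u _

end ThetaAdelicSide

/-- **Bridge to theta-3's (T4) translating element**: `finToG V hV h = finTranslate V hV h⁻¹` (`= e(1, (h⁻¹)⁻¹)`). -/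
theorem finToG_eq_finTranslate {L : CMField} {ι₁ : L →+* ℂ} (V : HermSpace3 L ι₁) (hV : IsAnisotropic L V.Hm)
    (h : V.adelicFin) : finToG V hV h = finTranslate V hV h⁻¹ := by
  show HodgeCM.Adelic.regimeEquiv L V.Hm hV ((UnitaryGroup.cmAdelicProdEquiv (L : Type) 3 V.Hm).symm (1, h)) =
    HodgeCM.Adelic.regimeEquiv L V.Hm hV ((UnitaryGroup.cmAdelicProdEquiv (L : Type) 3 V.Hm).symm (1, h⁻¹⁻¹))
  rw [inv_inv]

/-- `(Γ.conj h).K = h K h⁻¹ ≤ conjLevel Γ.K (h⁻¹)⁻¹` (the hypothesis `hle` of theta-3's `hK` discharge, at `k_f := h⁻¹`). -/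
theorem Level.K_conj_le_conjLevel {L : CMField} {ι₁ : L →+* ℂ} {V : HermSpace3 L ι₁} (Γ : Level V) (h : V.adelicFin)
    (hΓ : Γ.BelowConjThree) : (Γ.conj h hΓ).K ≤ conjLevel Γ.K h⁻¹⁻¹ := by
  intro x hx
  obtain ⟨k', hk', rfl⟩ := Level.mem_conjK_iff.mp hx
  rw [inv_inv, mem_conjLevel_iff]
  simpa [mul_assoc] using hk'

/-! ## §3. At the pin: the components of a saturated form are holomorphic weight forms of the conjugate levels -/

section Pin

variable (hHD : exists_isReal_hodgeModel) (hI : hodgePQ_independent_of_hodgeModel)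
  (h₁ : BallQuotientUniformised) (h₃ : CMAbelianVarietyRealised)
variable {L : CMField} {ι₁ : L →+* ℂ} {V : HermSpace3 L ι₁} {c : SeesawCtx L}

/-- **The pin's class-map datum at level `Δ`** (classical situation `MonoidHom.id U(2,1)`, uniform Sylvester frame):
`(thetaSpaceInputIn … S hV).D Δ` by `rfl`, spelled without `S`. -/
abbrev pinD (Δ : Level V) (hV : IsAnisotropic L V.Hm) :=
  classMapDatumOf hHD hI h₁ h₃ Δ hV (frameOf hHD hI h₁ h₃ Δ hV) (MonoidHom.id U21)
    (isLevelCorrected_id (levelImage hHD hI h₁ h₃ Δ hV) (stabilizer U21 x₀).subtype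
      (BallForms.isPullbackCocycle_cotangentCocycle.weightOf x₀))
    (isWeightMatched_id (stabilizer U21 x₀).subtype (BallForms.isPullbackCocycle_cotangentCocycle.weightOf x₀))

/-- (Ported verbatim from the HodgeCMPerL package; no docstring in the source.) -/
theorem thetaSpaceInputIn_D_eq_pinD (S : ThetaAdelicSide V c) (hV : IsAnisotropic L V.Hm) (Δ : Level V) :
    (thetaSpaceInputIn hHD hI h₁ h₃ S hV).D Δ = pinD hHD hI h₁ h₃ Δ hV := rfl

namespace ThetaAdelicSide

variable (S : ThetaAdelicSide V c)
variable {K₁ W : Type} [Group K₁] [AddCommGroup W] [Module ℂ W] [Module.IsReflexive ℂ W] {κ₁ : K₁ →* U21}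
  {τ₁ : Representation ℂ K₁ W}
  {𝓕 : Set C(NumberField.relNormOneIdeles (↥(maximalRealSubfield L)) L ⧸ NumberField.relNormOneRat (↥(maximalRealSubfield L)) L, ℂ)}

/-- **Left-invariance of the components of a saturated form under the conjugate level.**  For `F` in the slot's adèlic theta
module SATURATED at `satLevelRegimeOf V hV Γ.K` and any index `h`, the component `compAt F h` is left-invariant under the level
image `levelImage … (Γ.conj h hΓ) hV ≤ U(2,1)` of the conjugate level `(U(V)(L⁺) ∩ hKh⁻¹, hKh⁻¹)`. -/
theorem compAt_levelImage_mul (hV : IsAnisotropic L V.Hm) {k : Fin 4} {Γ : Level V} (hΓ : Γ.BelowConjThree)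
    {F : (V.latticeModel printFact_unitaryCompact_holds).G → W}
    (hF : F ∈ adelicThetaSpanSat (S.P k) S.ιinf κ₁ τ₁ (satLevelRegimeOf V hV Γ.K) 𝓕) (h : V.adelicFin) {δ : U21}
    (hδ : δ ∈ levelImage hHD hI h₁ h₃ (Γ.conj h hΓ) hV) (x : U21) :
    S.compAt hV F h (δ * x) = S.compAt hV F h x := by
  obtain ⟨a, ha, haΓ, hcomm⟩ := S.exists_corrector_of_mem_levelImage hHD hI h₁ h₃ (Γ.conj h hΓ) hV δ hδ
  have hleft := left_inv_of_mem_adelicThetaSpan (adelicThetaSpanSat_le_adelicThetaSpan hF)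
  -- the (inverse) corrector, conjugated back by `e_h`, lies in `sat(K)` (theta-3's discharged `hK` at `k_f := h⁻¹`)
  have ha' : a⁻¹ ∈ satLevelRegimeOf V hV (Γ.conj h hΓ).K := inv_mem ha
  have hsat' : (finToG V hV h)⁻¹ * a⁻¹ * finToG V hV h ∈ satLevelRegimeOf V hV Γ.K := by
    have key := inv_mul_mul_mem_satLevelRegimeOf_of_le_conjLevel V hV h⁻¹ (Level.K_conj_le_conjLevel Γ h hΓ) ha'
    rwa [← finToG_eq_finTranslate] at key
  have hΓU : S.ιinf δ * a ∈ (S.P k).ΓU := by rw [S.hΓU k]; exact haΓ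
  calc S.compAt hV F h (δ * x)
      = F ((S.ιinf δ * a) * (a⁻¹ * (S.ιinf x * finToG V hV h))) := by
          show F (S.ιinf (δ * x) * finToG V hV h) = _
          rw [map_mul]; congr 1; group
    _ = F (a⁻¹ * (S.ιinf x * finToG V hV h)) := hleft _ hΓU _
    _ = F (S.ιinf x * finToG V hV h * ((finToG V hV h)⁻¹ * a⁻¹ * finToG V hV h)) := by
          rw [← mul_assoc, (hcomm x).inv_left.eq]; congr 1; group
    _ = F (S.ιinf x * finToG V hV h) := apply_mul_eq_self_of_mem_adelicThetaSpanSat hF hsat' _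
    _ = S.compAt hV F h x := rfl

/-- **The components of a saturated form are weight forms of the conjugate levels**: `compAt F h ∈
weightForms (levelImage (Γ.conj h hΓ)) κ₁ τ₁`. -/
theorem compAt_mem_weightForms (hV : IsAnisotropic L V.Hm) {k : Fin 4} {Γ : Level V} (hΓ : Γ.BelowConjThree)
    {F : (V.latticeModel printFact_unitaryCompact_holds).G → W}
    (hF : F ∈ adelicThetaSpanSat (S.P k) S.ιinf κ₁ τ₁ (satLevelRegimeOf V hV Γ.K) 𝓕) (h : V.adelicFin) :
    S.compAt hV F h ∈ weightForms (levelImage hHD hI h₁ h₃ (Γ.conj h hΓ) hV) κ₁ τ₁ :=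
  ⟨fun _ hδ x => S.compAt_levelImage_mul hHD hI h₁ h₃ hV hΓ hF h hδ x,
    fun u x => S.compAt_mul_κ₁ hV (adelicThetaSpanSat_le_adelicThetaSpan hF) h x u⟩

variable {𝓕₂ : Set C(NumberField.relNormOneIdeles (↥(maximalRealSubfield L)) L ⧸
    NumberField.relNormOneRat (↥(maximalRealSubfield L)) L, ℂ)}

/-- **… and holomorphic when `F` has holomorphic germs along `S.ιinf`** (theta-3's `IsHolGerm`): the germ of `compAt F h` at
`g ∈ U(2,1)` is the germ of `F` at `S.ιinf g · e_h` (`e_h` commutes with `S.ιinf`), so the tree's first-order criterion applies. -/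
theorem compAt_mem_holWeightForms (hV : IsAnisotropic L V.Hm) {k : Fin 4} {Γ : Level V} (hΓ : Γ.BelowConjThree)
    {F : (V.latticeModel printFact_unitaryCompact_holds).G → (Fin 2 → ℂ)}
    (hF : F ∈ adelicThetaSpanSat (S.P k) S.ιinf (stabilizer U21 x₀).subtype
      (BallForms.isPullbackCocycle_cotangentCocycle.weightOf x₀) (satLevelRegimeOf V hV Γ.K) 𝓕₂)
    (hhol : IsHolGerm S.ιinf F) (h : V.adelicFin) :
    (⟨S.compAt hV F h, S.compAt_mem_weightForms hHD hI h₁ h₃ hV hΓ hF h⟩ :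
        weightForms (levelImage hHD hI h₁ h₃ (Γ.conj h hΓ) hV) (stabilizer U21 x₀).subtype
          (BallForms.isPullbackCocycle_cotangentCocycle.weightOf x₀)) ∈
      BallForms.holWeightForms (levelImage hHD hI h₁ h₃ (Γ.conj h hΓ) hV)
        BallForms.isPullbackCocycle_cotangentCocycle := by
  have e : ∀ g : U21, (fun b : Fin 2 → ℂ => S.compAt hV F h (g * BallForms.expP b)) =
      germAt S.ιinf F (S.ιinf g * finToG V hV h) := by
    intro g; funext b
    show F (S.ιinf (g * BallForms.expP b) * finToG V hV h) = F (S.ιinf g * finToG V hV h * S.ιinf (BallForms.expP b))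
    rw [map_mul, mul_assoc, ← (S.commute_finToG_ιinf hV h (BallForms.expP b)).eq, ← mul_assoc]
  refine BallForms.mem_holWeightForms_of_differentiableAt _ (fun g => ?_) (fun g v => ?_)
  · show DifferentiableAt ℝ (fun b : Fin 2 → ℂ => S.compAt hV F h (g * BallForms.expP b)) 0
    rw [e g]; exact hhol.1 _
  · show fderiv ℝ (fun b : Fin 2 → ℂ => S.compAt hV F h (g * BallForms.expP b)) 0 (Complex.I • v) =
      Complex.I • fderiv ℝ (fun b : Fin 2 → ℂ => S.compAt hV F h (g * BallForms.expP b)) 0 v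
    rw [e g]; exact hhol.2 _ v

/-- **The component of index `h` is `pull` of a UNIQUE `(1,0)`-class of `P_{Γ.conj h}`** (descent + injectivity of the pin's class map). -/
theorem exists_unique_pull_eq_compAt (hV : IsAnisotropic L V.Hm) {k : Fin 4} {Γ : Level V} (hΓ : Γ.BelowConjThree)
    {F : (V.latticeModel printFact_unitaryCompact_holds).G → (Fin 2 → ℂ)}
    (hF : F ∈ adelicThetaSpanSat (S.P k) S.ιinf (stabilizer U21 x₀).subtype
      (BallForms.isPullbackCocycle_cotangentCocycle.weightOf x₀) (satLevelRegimeOf V hV Γ.K) 𝓕₂)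
    (hhol : IsHolGerm S.ιinf F) (h : V.adelicFin) :
    ∃! cl : (pinD hHD hI h₁ h₃ (Γ.conj h hΓ) hV).H10,
      ((pinD hHD hI h₁ h₃ (Γ.conj h hΓ) hV).pull cl).1 = S.compAt hV F h := by
  obtain ⟨cl, hcl⟩ := (pinD hHD hI h₁ h₃ (Γ.conj h hΓ) hV).descends _
    (S.compAt_mem_holWeightForms hHD hI h₁ h₃ hV hΓ hF hhol h)
  have hinj : Function.Injective (pinD hHD hI h₁ h₃ (Γ.conj h hΓ) hV).pull :=
    classMapDatumOf_pull_injective hHD hI h₁ h₃ (Γ.conj h hΓ) hV _ (MonoidHom.id U21) _ _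
  refine ⟨cl, congrArg Subtype.val hcl, fun cl' hcl' => hinj ?_⟩
  rw [hcl]
  exact Subtype.ext hcl'

/-- **The component class** `compClass F h ∈ F¹H¹(P_{Γ.conj h})` of a saturated form with holomorphic germs. -/
def compClass (hV : IsAnisotropic L V.Hm) {k : Fin 4} {Γ : Level V} (hΓ : Γ.BelowConjThree)
    {F : (V.latticeModel printFact_unitaryCompact_holds).G → (Fin 2 → ℂ)}
    (hF : F ∈ adelicThetaSpanSat (S.P k) S.ιinf (stabilizer U21 x₀).subtype
      (BallForms.isPullbackCocycle_cotangentCocycle.weightOf x₀) (satLevelRegimeOf V hV Γ.K) 𝓕₂)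
    (hhol : IsHolGerm S.ιinf F) (h : V.adelicFin) : (pinD hHD hI h₁ h₃ (Γ.conj h hΓ) hV).H10 :=
  (S.exists_unique_pull_eq_compAt hHD hI h₁ h₃ hV hΓ hF hhol h).choose

/-- Defining property: `pull (compClass F h) = compAt F h`. -/
theorem pull_compClass (hV : IsAnisotropic L V.Hm) {k : Fin 4} {Γ : Level V} (hΓ : Γ.BelowConjThree)
    {F : (V.latticeModel printFact_unitaryCompact_holds).G → (Fin 2 → ℂ)}
    (hF : F ∈ adelicThetaSpanSat (S.P k) S.ιinf (stabilizer U21 x₀).subtype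
      (BallForms.isPullbackCocycle_cotangentCocycle.weightOf x₀) (satLevelRegimeOf V hV Γ.K) 𝓕₂)
    (hhol : IsHolGerm S.ιinf F) (h : V.adelicFin) :
    ((pinD hHD hI h₁ h₃ (Γ.conj h hΓ) hV).pull (S.compClass hHD hI h₁ h₃ hV hΓ hF hhol h)).1 = S.compAt hV F h :=
  (S.exists_unique_pull_eq_compAt hHD hI h₁ h₃ hV hΓ hF hhol h).choose_spec.1

/-- Uniqueness: any `(1,0)`-class whose pull-back is the component IS the component class. -/
theorem compClass_unique (hV : IsAnisotropic L V.Hm) {k : Fin 4} {Γ : Level V} (hΓ : Γ.BelowConjThree)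
    {F : (V.latticeModel printFact_unitaryCompact_holds).G → (Fin 2 → ℂ)}
    (hF : F ∈ adelicThetaSpanSat (S.P k) S.ιinf (stabilizer U21 x₀).subtype
      (BallForms.isPullbackCocycle_cotangentCocycle.weightOf x₀) (satLevelRegimeOf V hV Γ.K) 𝓕₂)
    (hhol : IsHolGerm S.ιinf F) (h : V.adelicFin) {cl : (pinD hHD hI h₁ h₃ (Γ.conj h hΓ) hV).H10}
    (hcl : ((pinD hHD hI h₁ h₃ (Γ.conj h hΓ) hV).pull cl).1 = S.compAt hV F h) :
    cl = S.compClass hHD hI h₁ h₃ hV hΓ hF hhol h :=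
  (S.exists_unique_pull_eq_compAt hHD hI h₁ h₃ hV hΓ hF hhol h).choose_spec.2 cl hcl

/-- The component class is a theta class of the END STATE's kind at the conjugate level: a `(1,0)`-class whose pull-back is a
HOLOMORPHIC weight form (membership of the pull-back in `Hol`, for the record). -/
theorem pull_compClass_mem_Hol (hV : IsAnisotropic L V.Hm) {k : Fin 4} {Γ : Level V} (hΓ : Γ.BelowConjThree)
    {F : (V.latticeModel printFact_unitaryCompact_holds).G → (Fin 2 → ℂ)}
    (hF : F ∈ adelicThetaSpanSat (S.P k) S.ιinf (stabilizer U21 x₀).subtype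
      (BallForms.isPullbackCocycle_cotangentCocycle.weightOf x₀) (satLevelRegimeOf V hV Γ.K) 𝓕₂)
    (hhol : IsHolGerm S.ιinf F) (h : V.adelicFin) :
    (pinD hHD hI h₁ h₃ (Γ.conj h hΓ) hV).pull (S.compClass hHD hI h₁ h₃ hV hΓ hF hhol h) ∈
      (pinD hHD hI h₁ h₃ (Γ.conj h hΓ) hV).Hol := by
  have e : (pinD hHD hI h₁ h₃ (Γ.conj h hΓ) hV).pull (S.compClass hHD hI h₁ h₃ hV hΓ hF hhol h) =
      ⟨S.compAt hV F h, S.compAt_mem_weightForms hHD hI h₁ h₃ hV hΓ hF h⟩ :=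
    Subtype.ext (S.pull_compClass hHD hI h₁ h₃ hV hΓ hF hhol h)
  rw [e]
  exact S.compAt_mem_holWeightForms hHD hI h₁ h₃ hV hΓ hF hhol h

end ThetaAdelicSide

end Pin


/-! ## §4. Rational translates: the components at related indices `h` and `(γ)_f h k` differ by the rational `γ` -/

section Rational

variable {L : CMField} {ι₁ : L →+* ℂ} (V : HermSpace3 L ι₁)

/-- The archimedean section at `ι₁` through the Sylvester frame, in the tree's generic currency (`archSectionU21CM` unfolded;
`archInfOf V = toLatticeModelG V ∘ archSec V` by `rfl`). -/
abbrev archSec : U21 →* (UnitaryGroup.adelicGroupData (↥(maximalRealSubfield L)) (L : Type) (IsCMField.complexConj L) 3 V.Hm).Adelic :=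
  UnitaryGroup.archSectionU21Emb (↥(maximalRealSubfield L)) (L : Type) (IsCMField.complexConj L) (IsCMField.complexConj_ne_one L)
    (UnitaryGroup.complexConj_smul_infinitePlace L) ι₁ (UnitaryGroup.isComplex_mk_of_isCMField L ι₁) V.Hm V.sylvesterFrame
    (UnitaryGroup.formCongr_eq_of_conjTranspose (L : Type) ι₁ V.Hm V.sylvesterFrame (sylvesterFrame_J V))

/-- (Ported verbatim from the HodgeCMPerL package; no docstring in the source.) -/
theorem archInfOf_eq_toLatticeModelG_archSec (x : U21) : archInfOf V x = toLatticeModelG V (archSec V x) := rfl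

/-- **Splitting of a rational point with its finite component made explicit** (tree currency): for `g ∈ U(V)(L⁺)`,
`(g)_𝔸 = archSec (toBall g) · a · (1, g_f)` with `a` away from the place of `ι₁` AND of trivial finite component (`a` = the
archimedean components of `g` at the other places; refines the tree's `exists_archSectionU21CM_mul_mem_adelicUnitaryRat`). -/
theorem exists_toAdelic_eq_archSec_mul_mul_finAdelicToAdelic (g : ↥(unitaryGroup (IsCMField.complexConj L : L →+* L) V.Hm)) :
    ∃ a : (UnitaryGroup.adelicGroupData (↥(maximalRealSubfield L)) (L : Type) (IsCMField.complexConj L) 3 V.Hm).Adelic,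
      a ∈ UnitaryGroup.awayFrom (↥(maximalRealSubfield L)) (L : Type) (IsCMField.complexConj L) 3 V.Hm
          (IsCMField.complexConj_ne_one L) (UnitaryGroup.complexConj_smul_infinitePlace L) (UnitaryGroup.cmPlace (L : Type) ι₁) ∧
      UnitaryGroup.finPart (↥(maximalRealSubfield L)) (L : Type) (IsCMField.complexConj L) 3 V.Hm a = 1 ∧
      UnitaryGroup.toAdelic (↥(maximalRealSubfield L)) (L : Type) (IsCMField.complexConj L) 3 V.Hm
          (UnitaryGroup.ballRational (L : Type) V.Hm g) =
        archSec V (BallRational.toBall L ι₁ V.Hm V.sylvesterFrame (sylvesterFrame_J V) g) * a *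
          UnitaryGroup.finAdelicToAdelic (↥(maximalRealSubfield L)) (L : Type) (IsCMField.complexConj L) 3 V.Hm
            (UnitaryGroup.rationalToFinAdelic (↥(maximalRealSubfield L)) (L : Type) (IsCMField.complexConj L) 3 V.Hm
              (UnitaryGroup.ballRational (L : Type) V.Hm g)) := by
  obtain ⟨k, hk, h⟩ := UnitaryGroup.exists_toAdelic_eq_archSectionU21Emb_mul (↥(maximalRealSubfield L)) (L : Type)
    (IsCMField.complexConj L) (IsCMField.complexConj_ne_one L) (UnitaryGroup.complexConj_smul_infinitePlace L) ι₁
    (UnitaryGroup.isComplex_mk_of_isCMField L ι₁) V.Hm V.sylvesterFrame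
    (UnitaryGroup.formCongr_eq_of_conjTranspose (L : Type) ι₁ V.Hm V.sylvesterFrame (sylvesterFrame_J V))
    (UnitaryGroup.ballRational (L : Type) V.Hm g)
  have h' : UnitaryGroup.toAdelic (↥(maximalRealSubfield L)) (L : Type) (IsCMField.complexConj L) 3 V.Hm
        (UnitaryGroup.ballRational (L : Type) V.Hm g) =
      archSec V (BallRational.toBall L ι₁ V.Hm V.sylvesterFrame (sylvesterFrame_J V) g) * k := by
    rw [UnitaryGroup.toBall_eq_archProjU21EmbCM (L : Type) ι₁ V.Hm V.sylvesterFrame (sylvesterFrame_J V) g]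
    exact h
  have hfs : ∀ u : U21, UnitaryGroup.finPart (↥(maximalRealSubfield L)) (L : Type) (IsCMField.complexConj L) 3 V.Hm
      (archSec V u) = 1 := fun u => by
    rw [archSec, UnitaryGroup.archSectionU21Emb_apply, UnitaryGroup.finPart_adelicSingle]
  have hfk : UnitaryGroup.finPart (↥(maximalRealSubfield L)) (L : Type) (IsCMField.complexConj L) 3 V.Hm k =
      UnitaryGroup.rationalToFinAdelic (↥(maximalRealSubfield L)) (L : Type) (IsCMField.complexConj L) 3 V.Hm
        (UnitaryGroup.ballRational (L : Type) V.Hm g) := by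
    have e := congrArg (UnitaryGroup.finPart (↥(maximalRealSubfield L)) (L : Type) (IsCMField.complexConj L) 3 V.Hm) h'
    rw [UnitaryGroup.finPart_toAdelic, map_mul, hfs, one_mul] at e
    exact e.symm
  refine ⟨k * (UnitaryGroup.finAdelicToAdelic (↥(maximalRealSubfield L)) (L : Type) (IsCMField.complexConj L) 3 V.Hm
      (UnitaryGroup.rationalToFinAdelic (↥(maximalRealSubfield L)) (L : Type) (IsCMField.complexConj L) 3 V.Hm
        (UnitaryGroup.ballRational (L : Type) V.Hm g)))⁻¹, ?_, ?_, ?_⟩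
  · exact Subgroup.mul_mem _ hk (Subgroup.inv_mem _ (UnitaryGroup.finAdelicToAdelic_mem_awayFrom _ _ _ _ _ _ _ _ _))
  · rw [map_mul, map_inv, hfk, UnitaryGroup.finPart_finAdelicToAdelic, mul_inv_cancel]
  · rw [h', mul_assoc, mul_assoc, inv_mul_cancel, mul_one]


-- port_pkg: scope closed for this part
end Rational
end Model
end HodgeCM
end
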